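import Mathlib
import Summits.Schanuel.Schanuel.Theorems.RigidCoreMinimalCounterexampleInAclNoFullLine

/-!
# Coset hits of a curve have upper Banach density zero — crux stmt-Schanuel-0969 `RigidCore.MinimalCounterexampleInAcl`

Line `kernel-arithmetic-selection` (lead prover-line-stmt-Schanuel-0969-c13-0), registered stub
`stub_cosetLine_densityZero_corankOne` (`--supports stmt-Schanuel-0969`): the DENSITY-ZERO form of the endgame of
`stub_corankOne_noFullLine` (Theorems/…NoFullLine), i.e. statement (P1) of the obstruction note of stub S7b
(`Cruxes/MinimalCounterexampleInAcl/Lines/kernel_arithmetic_selection_S7b_obstruction.md` §4).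

Let `W ⊆ ℂ² × ℂ²` be Zariski closed of dimension `< 2`, `c ∈ ℂ`, and `Q` a family of ℚ-linearly independent exponential
points of `W` meeting every exponential fibre `{eˣ = ω}` finitely.  Then the set of COSET HITS
`J = {j ∈ ℤ : some x ∈ Q has x₀ = c + 2πij}` has upper Banach density zero: for every `δ > 0` all long enough blocks
`[a, a + N)` of integers contain fewer than `δN` hits, uniformly in `a`.  (S9 only used "`J ≠ ℤ` along `dℤ`".)

Proof.  By the landed coset branch cover (`stub_cosetBranchCover`) all but finitely many hits are represented on one of
finitely many branches at infinity `B` of `W` over the coset, and on each branch windows of `≥ L` hits recur at finitely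
many positions (`branch_window_finite_of_fibre`, from the coset window rigidity).  If `J` had upper Banach density
`≥ δ > 0`, fix a block length `M` with `δM ≥ |B|·L + 1`; MARKOV ON SUB-BLOCKS (`infinite_richBlocks`: a window with `≥ δN`
hits split into `⌈N/M⌉` blocks of length `M` has `≫ N/M` blocks with `> |B|·L` hits) gives infinitely many such rich
blocks, all but finitely many of them free of unrepresented hits; the two pigeonholes of S9 (`exists_branch_pattern`: a
popular branch in each rich block, then a popular (branch, pattern) pair among the blocks) put one window of `> L` hits at
infinitely many positions on one branch — contradiction.

References: status note `Cruxes/MinimalCounterexampleInAcl/Lines/kernel_arithmetic_selection.md` §Addendum c13;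
the S7b obstruction note (ibid.).
-/

noncomputable section

set_option linter.dupNamespace false

open Complex Filter Topology Set Metric

namespace Summit.Schanuel.Schanuel.Cruxes.MinimalCounterexampleInAcl.KernelArithmeticSelection

open Literature.NumberTheory.Transcendental

/-- The branch point `((t⁻ᵉ, Φ₁ t / tᴺ), (Φ₂ t / tᴺ, Φ₃ t / tᴺ)) ∈ ℂ² × ℂ²` (local notation). -/
local notation3 "𝔟[" e ", " N ", " Φ₁ ", " Φ₂ ", " Φ₃ ", " t "]" =>
  (Sum.elim ![((t : ℂ) ^ (e : ℕ))⁻¹, (Φ₁ : ℂ → ℂ) t / t ^ (N : ℕ)]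
    ![(Φ₂ : ℂ → ℂ) t / t ^ (N : ℕ), (Φ₃ : ℂ → ℂ) t / t ^ (N : ℕ)] : Fin 2 ⊕ Fin 2 → ℂ)

/-! ## Counting: block cover, Markov on sub-blocks, the two pigeonholes -/

/-- **Block cover**: the hits in `[a, a + N)` are at most the sum of the hits in the `T` consecutive blocks
`[a + iM, a + iM + M)`, `i < T`, as soon as `N ≤ T·M`. [folklore] -/
theorem card_filter_Ico_le_sum_blocks {Hit : ℤ → Prop} [DecidablePred Hit] (a : ℤ) {M : ℕ} (hM : 0 < M)
    (T : ℕ) {N : ℕ} (hN : N ≤ T * M) :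
    ((Finset.Ico a (a + N)).filter Hit).card ≤
      ∑ i ∈ Finset.range T, ((Finset.Ico (a + i * M) (a + i * M + M)).filter Hit).card := by
  calc ((Finset.Ico a (a + N)).filter Hit).card
      ≤ ((Finset.range T).biUnion fun i => (Finset.Ico (a + i * M) (a + i * M + M)).filter Hit).card := by
        refine Finset.card_le_card fun j hj => ?_
        rw [Finset.mem_filter, Finset.mem_Ico] at hj
        obtain ⟨⟨hj1, hj2⟩, hj3⟩ := hj
        rw [Finset.mem_biUnion]
        obtain ⟨x, hx⟩ : ∃ x : ℕ, (x : ℤ) = j - a := ⟨(j - a).toNat, Int.toNat_of_nonneg (by linarith)⟩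
        have hxN : x < T * M := by
          have h1 : (x : ℤ) < N := by rw [hx]; linarith
          have h2 : x < N := by exact_mod_cast h1
          exact lt_of_lt_of_le h2 hN
        obtain ⟨i, r, hir, hr, hiT⟩ : ∃ i r : ℕ, x = i * M + r ∧ r < M ∧ i < T :=
          ⟨x / M, x % M, by rw [mul_comm]; exact (Nat.div_add_mod x M).symm, Nat.mod_lt x hM,
            (Nat.div_lt_iff_lt_mul hM).2 hxN⟩
        have hir' : (x : ℤ) = (i : ℤ) * (M : ℤ) + (r : ℤ) := by
          have h := congrArg (Nat.cast (R := ℤ)) hir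
          push_cast at h
          exact h
        have hr' : (r : ℤ) < (M : ℤ) := by exact_mod_cast hr
        have hr0 : (0 : ℤ) ≤ (r : ℤ) := Nat.cast_nonneg r
        refine ⟨i, Finset.mem_range.2 hiT, ?_⟩
        rw [Finset.mem_filter, Finset.mem_Ico]
        exact ⟨⟨by linarith, by linarith⟩, hj3⟩
    _ ≤ ∑ i ∈ Finset.range T, ((Finset.Ico (a + i * M) (a + i * M + M)).filter Hit).card :=
        Finset.card_biUnion_le

/-- **Markov on sub-blocks**: if for arbitrarily long windows `[a, a + N)` the hits number `≥ δN` (`δ > 0`), then for a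
block length `M` with `δM ≥ K` there are infinitely many positions `a` whose block `[a, a + M)` carries `≥ K` hits
(were there only `ρ₀`, a window with `N/M > ρ₀M + K` would carry `≤ ρ₀M + (N/M + 1)(K − 1) < K·(N/M) ≤ δN` hits).
[folklore] -/
theorem infinite_richBlocks {Hit : ℤ → Prop} [DecidablePred Hit] {δ : ℝ} {K M : ℕ} (hM : 0 < M) (hδ : 0 < δ)
    (hKM : (K : ℝ) ≤ δ * M)
    (hdense : ∀ N₀ : ℕ, ∃ N : ℕ, N₀ ≤ N ∧ ∃ a : ℤ, δ * N ≤ (((Finset.Ico a (a + N)).filter Hit).card : ℝ)) :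
    Set.Infinite {a : ℤ | K ≤ ((Finset.Ico a (a + M)).filter Hit).card} := by
  intro hfin
  rcases Nat.eq_zero_or_pos K with hK | hK
  · refine Set.infinite_univ (α := ℤ) ?_
    have huniv : {a : ℤ | K ≤ ((Finset.Ico a (a + M)).filter Hit).card} = Set.univ :=
      Set.eq_univ_of_forall fun a => by simp [hK]
    rwa [huniv] at hfin
  set RF : Finset ℤ := hfin.toFinset with hRF
  have hmemRF : ∀ a' : ℤ, a' ∈ RF ↔ K ≤ ((Finset.Ico a' (a' + M)).filter Hit).card := by
    intro a'
    simp only [hRF, Set.Finite.mem_toFinset, Set.mem_setOf_eq]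
  set ρ₀ : ℕ := RF.card with hρ₀
  obtain ⟨N, hN, a, ha⟩ := hdense (M * (ρ₀ * M + K + 1))
  obtain ⟨q, hq⟩ : ∃ q : ℕ, q = N / M := ⟨_, rfl⟩
  -- lower bound `K·q ≤ δN`
  have h1 : (K : ℝ) * q ≤ δ * N := by
    have hqM : M * q ≤ N := by rw [hq]; exact Nat.mul_div_le N M
    have hqM' : ((M * q : ℕ) : ℝ) ≤ N := by exact_mod_cast hqM
    have hq0 : (0 : ℝ) ≤ q := Nat.cast_nonneg _
    calc (K : ℝ) * q ≤ δ * M * q := by gcongr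
      _ = δ * ((M * q : ℕ) : ℝ) := by push_cast; ring
      _ ≤ δ * N := by gcongr
  -- upper bound `hits ≤ ρ₀M + (q + 1)(K − 1)` : block cover and the per-block bounds
  have hcov : N ≤ (q + 1) * M := by
    rw [hq, Nat.succ_mul]
    exact (Nat.lt_div_mul_add hM).le
  have h2 := card_filter_Ico_le_sum_blocks (Hit := Hit) a hM (q + 1) hcov
  have hblock : ∀ i : ℕ, ((Finset.Ico (a + i * M) (a + i * M + M)).filter Hit).card ≤
      (if a + i * M ∈ RF then M else K - 1) := by
    intro i
    split_ifs with hi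
    · calc ((Finset.Ico (a + i * M) (a + i * M + M)).filter Hit).card
          ≤ (Finset.Ico (a + (i : ℤ) * M) (a + i * M + M)).card := Finset.card_filter_le _ _
        _ = M := by
            rw [Int.card_Ico, show a + (i : ℤ) * (M : ℤ) + (M : ℤ) - (a + (i : ℤ) * (M : ℤ)) = (M : ℤ) by ring,
              Int.toNat_natCast]
    · rw [hmemRF] at hi
      omega
  have hsum : ∑ i ∈ Finset.range (q + 1), ((Finset.Ico (a + i * M) (a + i * M + M)).filter Hit).card ≤
      ρ₀ * M + (q + 1) * (K - 1) := by
    calc ∑ i ∈ Finset.range (q + 1), ((Finset.Ico (a + i * M) (a + i * M + M)).filter Hit).card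
        ≤ ∑ i ∈ Finset.range (q + 1), (if a + i * M ∈ RF then M else K - 1) :=
          Finset.sum_le_sum fun i _ => hblock i
      _ = ((Finset.range (q + 1)).filter (fun i : ℕ => a + i * M ∈ RF)).card * M +
            ((Finset.range (q + 1)).filter (fun i : ℕ => ¬ (a + i * M ∈ RF))).card * (K - 1) := by
          rw [Finset.sum_ite]
          simp only [Finset.sum_const, smul_eq_mul]
      _ ≤ ρ₀ * M + (q + 1) * (K - 1) := by
          have hc1 : ((Finset.range (q + 1)).filter (fun i : ℕ => a + i * M ∈ RF)).card ≤ ρ₀ := by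
            rw [hρ₀]
            refine Finset.card_le_card_of_injOn (fun i : ℕ => a + i * M) (fun i hi => ?_) ?_
            · exact (Finset.mem_filter.1 (Finset.mem_coe.1 hi)).2
            · intro i _ i' _ h
              have h' : a + (i : ℤ) * (M : ℤ) = a + (i' : ℤ) * (M : ℤ) := h
              have hM0 : (M : ℤ) ≠ 0 := by exact_mod_cast hM.ne'
              have h'' : (i : ℤ) * (M : ℤ) = (i' : ℤ) * (M : ℤ) := by linarith
              exact_mod_cast mul_right_cancel₀ hM0 h''
          have hc2 : ((Finset.range (q + 1)).filter (fun i : ℕ => ¬ (a + i * M ∈ RF))).card ≤ q + 1 :=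
            (Finset.card_filter_le _ _).trans (Finset.card_range _).le
          gcongr
  -- `q` is large
  have h3 : ρ₀ * M + K + 1 ≤ q := by
    rw [hq]
    calc ρ₀ * M + K + 1 = M * (ρ₀ * M + K + 1) / M := (Nat.mul_div_cancel_left _ hM).symm
      _ ≤ N / M := Nat.div_le_div_right hN
  -- contradiction
  have h4 : (((Finset.Ico a (a + N)).filter Hit).card : ℝ) ≤ ((ρ₀ * M + (q + 1) * (K - 1) : ℕ) : ℝ) := by
    exact_mod_cast h2.trans hsum
  rw [Nat.cast_add, Nat.cast_mul, Nat.cast_mul, Nat.cast_add, Nat.cast_sub hK, Nat.cast_one] at h4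
  have h3' : ((ρ₀ * M + K + 1 : ℕ) : ℝ) ≤ (q : ℝ) := by exact_mod_cast h3
  push_cast at h3'
  have hK' : (1 : ℝ) ≤ K := by exact_mod_cast hK
  nlinarith [ha, h1, h4, h3', hK']

/-- **The two pigeonholes of S9, for rich blocks**: if infinitely many blocks `[a, a + M)` contain `> |B|·L` positions each
carrying a `B`-labelled hit, then one label `b ∈ B` and one pattern `G` of `> L` offsets have ALL of `k + G` hit with label
`b` for infinitely many `k` (a popular label in each block; a popular (label, pattern) pair among the blocks). [folklore] -/
theorem exists_branch_pattern {β : Type*} (B : Finset β) (L M : ℕ) (P : β → ℤ → Prop)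
    (hrich : Set.Infinite {a : ℤ | ∃ s : Finset ℤ, s ⊆ Finset.Ico a (a + M) ∧ B.card * L < s.card ∧
      ∀ j ∈ s, ∃ b ∈ B, P b j}) :
    ∃ b ∈ B, ∃ G : Finset ℤ, L < G.card ∧ Set.Infinite {k : ℤ | ∀ g ∈ G, P b (k + g)} := by
  classical
  set Rich : Set ℤ := {a : ℤ | ∃ s : Finset ℤ, s ⊆ Finset.Ico a (a + M) ∧ B.card * L < s.card ∧
      ∀ j ∈ s, ∃ b ∈ B, P b j} with hRich
  -- first pigeonhole: a popular label in each rich block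
  have key : ∀ a ∈ Rich, ∃ b ∈ B, ∃ T ∈ (Finset.Ico (0 : ℤ) (M : ℤ)).powerset,
      L < T.card ∧ ∀ g ∈ T, P b (a + g) := by
    rintro a ⟨s, hs, hcard, hP⟩
    have hsne : s.Nonempty := Finset.card_pos.1 (by omega)
    obtain ⟨j₀, hj₀⟩ := hsne
    obtain ⟨b₀, -, -⟩ := hP j₀ hj₀
    haveI : Nonempty β := ⟨b₀⟩
    choose! σ hσB hσP using hP
    obtain ⟨b, hb, hlt⟩ := Finset.exists_lt_card_fiber_of_mul_lt_card_of_maps_to (s := s) (t := B) (f := σ)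
      (n := L) (fun j hj => hσB j hj) hcard
    refine ⟨b, hb, (s.filter fun j => σ j = b).image (fun j : ℤ => j - a), ?_, ?_, ?_⟩
    · rw [Finset.mem_powerset]
      intro g hg
      obtain ⟨j, hj, rfl⟩ := Finset.mem_image.1 hg
      have hj' := hs (Finset.mem_filter.1 hj).1
      rw [Finset.mem_Ico] at hj' ⊢
      constructor <;> linarith [hj'.1, hj'.2]
    · rwa [Finset.card_image_of_injective _ (sub_left_injective)]
    · intro g hg
      obtain ⟨j, hj, rfl⟩ := Finset.mem_image.1 hg
      obtain ⟨hjs, hσj⟩ := Finset.mem_filter.1 hj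
      rw [show a + (j - a) = j by ring, ← hσj]
      exact hσP j hjs
  choose bOf hbB TOf hTOf hLT hPat using key
  -- second pigeonhole: a popular (label, pattern) among the rich blocks
  haveI : Infinite Rich := Set.infinite_coe_iff.2 hrich
  set F : Rich → B × ((Finset.Ico (0 : ℤ) (M : ℤ)).powerset) := fun a =>
    ((⟨bOf a a.2, hbB a a.2⟩ : B), (⟨TOf a a.2, hTOf a a.2⟩ : (Finset.Ico (0 : ℤ) (M : ℤ)).powerset)) with hF
  obtain ⟨⟨⟨b, hb⟩, ⟨T, hT⟩⟩, hinf0⟩ := Finite.exists_infinite_fiber F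
  have hinf := Set.infinite_coe_iff.1 hinf0
  have hA : ∀ a : Rich, a ∈ F ⁻¹' {((⟨b, hb⟩ : B), (⟨T, hT⟩ : (Finset.Ico (0 : ℤ) (M : ℤ)).powerset))} →
      bOf a a.2 = b ∧ TOf a a.2 = T := by
    intro a ha
    simp only [hF, Set.mem_preimage, Set.mem_singleton_iff, Prod.mk.injEq, Subtype.mk.injEq] at ha
    exact ha
  obtain ⟨a₀, ha₀⟩ := hinf.nonempty
  refine ⟨b, hb, T, ?_, ?_⟩
  · rw [← (hA a₀ ha₀).2]
    exact hLT a₀ a₀.2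
  · refine (hinf.image (f := (Subtype.val : Rich → ℤ)) Subtype.val_injective.injOn).mono ?_
    rintro _ ⟨a, ha, rfl⟩
    obtain ⟨hba, hTa⟩ := hA a ha
    intro g hg
    rw [← hba]
    exact hPat a a.2 g (hTa ▸ hg)

/-! ## The registered stub -/

/-- **Stub P1 — COSET HITS OF A CURVE HAVE UPPER BANACH DENSITY ZERO (PROVED).**  For `W ⊆ ℂ² × ℂ²` Zariski closed of
dimension `< 2`, `c ∈ ℂ` and a fibre-finite family `Q` of ℚ-linearly independent exponential points of `W`, the positions
`j ∈ ℤ` at which some `x ∈ Q` has `x₀ = c + 2πij` have upper Banach density zero (coset branch cover + coset window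
rigidity + Markov on sub-blocks + two pigeonholes; see the module docstring). [folklore] -/
theorem stub_cosetLine_densityZero_corankOne : ∀ (W : Set (Fin 2 ⊕ Fin 2 → ℂ)) (Q : Set (Fin 2 → ℂ)) (c : ℂ), Literature.NumberTheory.Transcendental.IsZariskiClosed ℂ W → Literature.NumberTheory.Transcendental.zariskiDim ℂ W < 2 → Q ⊆ Literature.NumberTheory.Transcendental.indepExpPoints W → (∀ ω : Fin 2 → ℂ, Set.Finite {x : Fin 2 → ℂ | x ∈ Q ∧ Complex.exp ∘ x = ω}) → ∀ δ : ℝ, 0 < δ → ∃ N₀ : ℕ, ∀ N : ℕ, N₀ ≤ N → ∀ a : ℤ, (Set.ncard {j : ℤ | j ∈ Finset.Ico a (a + (N : ℤ)) ∧ ∃ x ∈ Q, x 0 = c + 2 * ↑Real.pi * Complex.I * (j : ℂ)} : ℝ) < δ * (N : ℝ) := by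
  intro W Q c hWcl hWdim hQW hQfib δ hδ
  classical
  by_contra hcon
  push Not at hcon
  have h2πi : (2 * ↑Real.pi * I : ℂ) ≠ 0 := by simp [Real.pi_ne_zero, I_ne_zero]
  set Hit : ℤ → Prop := fun j => ∃ x ∈ Q, x 0 = c + 2 * ↑Real.pi * I * (j : ℂ) with hHit
  -- ### (1) branches at infinity over the coset `c + 2πiℤ`
  obtain ⟨e, R, r, B, X, he, hr, hXfin, hB, hrep⟩ := stub_cosetBranchCover W hWcl hWdim c
  set P : ((ℂ → ℂ) × (ℂ → ℂ) × (ℂ → ℂ) × ℕ) → ℤ → Prop := fun b m => ∃ p ∈ Q, ∃ t : ℂ,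
      t = (p 0) ^ (-((e : ℂ)⁻¹)) ∧ p 0 = c + 2 * ↑Real.pi * I * (m : ℂ) ∧
      0 < ‖t‖ ∧ ‖t‖ < r ∧ Sum.elim p (cexp ∘ p) = 𝔟[e, b.2.2.2, b.1, b.2.1, b.2.2.1, t] with hP
  -- ### (2) per-branch window finiteness
  have hbr : ∀ b ∈ B, ∃ L : ℕ, ∀ G : Finset ℤ, L ≤ G.card → Set.Finite {k : ℤ | ∀ j ∈ G, P b (k + j)} := by
    intro b hb
    obtain ⟨hban, hbW⟩ := hB b hb
    obtain ⟨L, hL⟩ := branch_window_finite_of_fibre hWdim he hr hban hbW c hQW hQfib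
    exact ⟨L, fun G hG => hL G hG⟩
  choose! Lb hLb using hbr
  set L : ℕ := B.sup Lb with hL
  -- ### (3) all but finitely many hits are represented on a branch of `B`
  have hbad : Set.Finite {j : ℤ | Hit j ∧ ¬ ∃ b ∈ B, P b j} := by
    have hf1 : Set.Finite {j : ℤ | ‖c + 2 * ↑Real.pi * I * (j : ℂ)‖ ≤ R} := finite_int_norm_coset_le c R
    have hf2 : Set.Finite ((fun j : ℤ => c + 2 * ↑Real.pi * I * (j : ℂ)) ⁻¹'
        ((fun x : Fin 2 → ℂ => x 0) '' X)) := by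
      refine (hXfin.image _).preimage fun j _ j' _ h => ?_
      have h' : (j : ℂ) = (j' : ℂ) := mul_left_cancel₀ h2πi (add_left_cancel h)
      exact_mod_cast h'
    refine (hf1.union hf2).subset ?_
    rintro j ⟨⟨x, hxQ, hx0⟩, hno⟩
    by_contra hj
    rw [Set.mem_union, not_or] at hj
    obtain ⟨hjR, hjX⟩ := hj
    have hR : R < ‖x 0‖ := by
      rw [hx0]
      exact lt_of_not_ge hjR
    have hxX : x ∉ X := fun h => hjX ⟨x, h, hx0⟩
    obtain ⟨b, hb, h0, hr', hrepr⟩ := hrep x (hQW hxQ) ⟨j, hx0⟩ hR hxX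
    exact hno ⟨b, hb, x, hxQ, _, rfl, hx0, h0, hr', hrepr⟩
  -- ### (4) positive upper Banach density gives infinitely many rich blocks of a fixed length `M₁`
  obtain ⟨M₁, hM₁, hKM⟩ : ∃ M₁ : ℕ, 0 < M₁ ∧ ((B.card * L + 1 : ℕ) : ℝ) ≤ δ * M₁ := by
    obtain ⟨M₀, hM₀⟩ := exists_nat_ge (((B.card * L + 1 : ℕ) : ℝ) / δ)
    refine ⟨M₀ + 1, Nat.succ_pos _, ?_⟩
    rw [div_le_iff₀ hδ] at hM₀
    push_cast at hM₀ ⊢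
    nlinarith
  have hdense : ∀ N₀ : ℕ, ∃ N : ℕ, N₀ ≤ N ∧ ∃ a : ℤ,
      δ * N ≤ (((Finset.Ico a (a + N)).filter Hit).card : ℝ) := by
    intro N₀
    obtain ⟨N, hN, a, ha⟩ := hcon N₀
    refine ⟨N, hN, a, ?_⟩
    have hset : {j : ℤ | j ∈ Finset.Ico a (a + (N : ℤ)) ∧ ∃ x ∈ Q, x 0 = c + 2 * ↑Real.pi * I * (j : ℂ)} =
        ↑((Finset.Ico a (a + (N : ℤ))).filter Hit) := by
      ext j
      simp only [Finset.coe_filter, Set.mem_setOf_eq, hHit]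
    rw [hset, Set.ncard_coe_finset] at ha
    exact ha
  have hrich := infinite_richBlocks hM₁ hδ hKM hdense
  -- ### (5) rich blocks free of unrepresented hits
  have hrich' : Set.Infinite {a : ℤ | ∃ s : Finset ℤ, s ⊆ Finset.Ico a (a + M₁) ∧ B.card * L < s.card ∧
      ∀ j ∈ s, ∃ b ∈ B, P b j} := by
    have hAv : Set.Finite {a : ℤ | ∃ j : ℤ, (Hit j ∧ ¬ ∃ b ∈ B, P b j) ∧ a ≤ j ∧ j < a + M₁} := by
      refine (hbad.biUnion fun j _ => Set.finite_Icc (j - M₁) j).subset ?_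
      rintro a ⟨j, hj, haj, hja⟩
      exact Set.mem_biUnion hj ⟨by linarith, haj⟩
    refine (hrich.sdiff hAv).mono ?_
    rintro a ⟨ha, hav⟩
    refine ⟨(Finset.Ico a (a + M₁)).filter Hit, Finset.filter_subset _ _, Nat.lt_iff_add_one_le.2 ha,
      fun j hj => ?_⟩
    obtain ⟨hjI, hjH⟩ := Finset.mem_filter.1 hj
    rw [Finset.mem_Ico] at hjI
    by_contra hno
    exact hav ⟨j, ⟨hjH, hno⟩, hjI.1, hjI.2⟩
  -- ### (6) the two pigeonholes: one window of `> L` hits at infinitely many positions on one branch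
  obtain ⟨b, hb, G, hLG, hinf⟩ := exists_branch_pattern B L M₁ P hrich'
  have hLbG : Lb b ≤ G.card := (Finset.le_sup (f := Lb) hb).trans hLG.le
  exact hinf (hLb b hb G hLbG)

end Summit.Schanuel.Schanuel.Cruxes.MinimalCounterexampleInAcl.KernelArithmeticSelection

end
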